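import Summits.ABC.IUTFork.Thm311RealInd1StripHullIdeals
import HarnessLib

/-!
# [IUTchIII] Thm 3.11 (i) (Ind1)+(Ind2) at `v ∈ 𝕍^non`: the DEPTH-`e` ball at residue degree one — if NO realised strip automorphism moves
# the base line modulo `𝔪_v^{e+1}`, the ball is FIXED by the whole realised strip group (UNCONDITIONAL branch of the depth-`e` dichotomy)

PROOF-ONLY file (abc-iut cell, Cor. 3.12 sub-crew, seat abc-iut-c312-1 = holder of record of the typed [IUTchIII] Thm. 3.11, gen 18; row
«R24 = C:F1-DEPTH-E-DICHOTOMY», KEY F1DICHOTOMY, C LEAD ruling C-R152 (f); file 1 of the row — the unconditional branch; file 2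
`Thm311RealInd1StripDepthEDichotomy` = the branch modulo `JannsenWingbergMappingClass` and the equivalence).  TAKES NO SIDE on [IUTchIII] Cor. 3.12.

SETTING.  One tame place `v ∣ p` (`p > 2`, `e = e(v|p) ≤ p − 2`, so `log_p(𝒪_v^×) = 𝔪_v`) and the DEPTH-`e` ball `M = {‖x‖ ≤ ‖c‖·p⁻¹}`
(`= c·𝔪_v^e = p·c·𝒪_v`, content `c ≠ 0`) — the one ideal-shaped region left open by `Thm311RealInd1StripHullIdeals` (p530814: hull identity for
`c·𝔪_v^n`, `1 ≤ n ≤ e`, unless `n = e ∧ f(v|p) = 1`).  At a genuine place-section packet the box factors off the twisted slot are exactly such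
balls (`p⁻¹·𝔪^{e_b} = 𝒪_b`), whence the residue-degree hypotheses `hf`/`hram`/`hres` of the junction files p538494–p547431.

THE BIT (one displayed binder, no new `Prop`): «SOME realised strip automorphism `ψ ∈ Real.ind1StripOf v (galoisLog v)` MOVES THE BASE
LINE `ℤ_p·p = log_p(1 + pℤ_p)` MODULO `p·log_p(𝒪_v^×) = 𝔪_v^{e+1}`», i.e. `ψ(p) − p ∉ p·log_p(𝒪_v^×)`; equivalently (`ψ` is `ℚ_p`-linear)
`ψ(1) − 1 ∉ log_p(𝒪_v^×) = 𝔪_v` (§0b `of_apply_natCast_sub_mem_smul_logUnits_iff`).  This file treats its NEGATION.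

* §0 (classical kit) `Hull.exists_norm_sub_natCast_lt_one_of_residueDegree_eq_one` (`f = 1` ⇒ `𝒪_K = ℤ + 𝔪_K`); §0c `symm_mem_ind1StripOf`
  (the strip part is closed under inverses: `ψ⁻¹` realises `φ⁻¹`).
* §1 (UNCONDITIONAL, `f(v|p) = 1`) **`of_apply_sub_mem_smul_logUnits_of_fixesBaseLine`** — if NO realised strip automorphism moves the
  base line mod `𝔪_v^{e+1}`, then every `ψ` displaces the points of the depth-`e` ball only inside `p·c·log_p(𝒪_v^×) = c·𝔪_v^{e+1}` (norm
  `≤ ‖c‖·p^{−(e+1)/e} < ‖c‖·p⁻¹`), so maps `M` into itself (`𝒪_v = ℤ + 𝔪_v` at residue degree one; `ψ − 1` maps `log_p(𝒪_v^×)` into itself,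
  R17b §1, and `1` into `log_p(𝒪_v^×)` by hypothesis); **`image_depthE_ball_eq_of_mem_closure_of_fixesBaseLine`** — every element of the GROUP
  generated by the realised strip automorphisms carries `M` ONTO itself: the strip orbit of `M` is `M`, its additive span is `M`, of hull
  `closedBall 0 (‖c‖·p⁻¹)` (`coe_span_depthE_ball_eq_closedBall`) — against the container's `closedBall 0 (‖c‖·p^{−1/e})` (`= c·𝔪_v`): NO
  inflation at `v` in this branch, a defect of `e − 1` steps of `𝔪_v` (log-volume `(e−1)/e·log p` per unit weight) whenever `e ≥ 2`.
READING (numbers about OUR typed objects, one finite place; neutral): the last un-typed residue of the tame odd-degree junction programme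
(gens 15–17) is ONE kernel-visible bit on the realised strip group — does it fix the base line `ℚ_p ⊆ K_v` to first order (`ψ(1) ≡ 1 mod 𝔪_v`
for all `ψ`) or not; print's (Ind2) `= ℤ_p^×·id` (abc-iut-w5-d216) fixes it; deciding the bit for print's (Ind1) needs a Galois-theoretic input on
`Aut(G_{K_v}) ↷ K_v^×/(K_v^×)^p` beyond `JannsenWingbergMappingClass` (Kondo 2025 p. 5 records the exact base-line question as open at odd degree).
HONEST SCOPE: single place; tame; `f(v|p) = 1`; OUR typing of print's (Ind1) (THE equivariant lift, THE logarithm; referee F-B28-1 untouched);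
statements about OUR typed strip group, not about print's indeterminacy group; no log-volume computed here; (Ind2)/(Ind3) and the log-link
untouched; no side taken on [IUTchIII] Cor. 3.12 / [IUTchIV] Thm. 1.10 or on any author; NO abc claim. [claim: Mochizuki2012, status: disputed];
[cite: Mochizuki2012, IUTchIII Thm. 3.11 (i) p. 154; Rmk. 3.9.5 (i) p. 126; Cor. 3.12 Step (xi) p. 183; IUTchIV Prop. 1.2 (i)–(ii) pp. 10–11];
[cite: Kondo2025OuterAutMLF, p. 5; §3 Rem 3.18]; [cite: DupuyHilado2025, §4.9, §4.12]; [cite: SerreLocalFields1979, Ch. I §6; Ch. III §6, Prop. 13].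
typed ≠ proved; a conditional theorem discharges nothing it binds; equal-AS-TYPED ≠ equal in print.
-/

set_option autoImplicit false

noncomputable section

open Metric Set
open scoped Pointwise

/-! ## §0 Kit: residue degree one means `𝒪_K = ℤ + 𝔪_K` (classical) -/

namespace Summit.ABC.IUTFork.Thm311.Real.Hull

open Module IsLocalRing Literature.IUT.LogVolume Literature.NumberTheory.GaloisRepresentations.Ultrametric
open scoped NormedField

variable {p : ℕ} [Fact p.Prime]
variable {K : Type} [NontriviallyNormedField K] [NormedAlgebra ℚ_[p] K] [IsUltrametricDist K] [ProperSpace K]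

variable (p K) in
/-- **Residue degree one: every integer of `K` is congruent to a rational integer `0 ≤ m < p` modulo `𝔪_K`** (`#(𝒪_K/𝔪) = p^f = p`, so the
injection `m ↦ [m·1]`, `0 ≤ m < p`, is onto). Converse of `residueDegree_le_one_of_forall_exists_norm_sub_algebraMap_lt_one`. [folklore]
[cite: SerreLocalFields1979, Ch. I §6] -/
theorem exists_norm_sub_natCast_lt_one_of_residueDegree_eq_one (hf : residueDegree p K = 1) (x : K) (hx : ‖x‖ ≤ 1) :
    ∃ m : ℕ, m < p ∧ ‖x - (m : K)‖ < 1 := by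
  classical
  have hP : p.Prime := Fact.out
  let O := Valued.integer K
  haveI : Finite (O ⧸ maximalIdeal O) := (finite_residueField : Finite (ResidueField O))
  letI : Fintype (O ⧸ maximalIdeal O) := Fintype.ofFinite _
  -- `‖m₁ − m₂‖ < 1` in `K` for naturals `m₁, m₂ < p` forces `m₁ = m₂`
  have hnat : ∀ m₁ m₂ : ℕ, m₁ < p → m₂ < p → ‖(m₁ : K) - (m₂ : K)‖ < 1 → m₁ = m₂ := by
    intro m₁ m₂ h₁ h₂ h
    have hK : ‖(m₁ : K) - (m₂ : K)‖ = ‖(((m₁ : ℤ) - (m₂ : ℤ) : ℤ) : ℚ_[p])‖ := by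
      rw [← norm_algebraMap' K (((m₁ : ℤ) - (m₂ : ℤ) : ℤ) : ℚ_[p]), map_intCast]
      push_cast; rfl
    rw [hK, Padic.norm_intCast_lt_one_iff] at h
    have hmod : m₂ ≡ m₁ [MOD p] := (Nat.modEq_iff_dvd).mpr h
    exact (hmod.symm.eq_of_lt_of_lt h₁ h₂)
  let ι : Fin p → O ⧸ maximalIdeal O := fun m => Ideal.Quotient.mk (maximalIdeal O) ((m : ℕ) : O)
  have hinj : Function.Injective ι := by
    intro m₁ m₂ h
    apply Fin.ext
    refine hnat m₁ m₂ m₁.2 m₂.2 ?_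
    change Ideal.Quotient.mk (maximalIdeal O) (((m₁ : ℕ) : O)) = Ideal.Quotient.mk (maximalIdeal O) (((m₂ : ℕ) : O)) at h
    rw [Ideal.Quotient.eq, mem_maximalIdeal_iff_norm_lt_one] at h
    have hval : ((((m₁ : ℕ) : O) - ((m₂ : ℕ) : O) : O) : K) = (m₁ : K) - (m₂ : K) := by push_cast; rfl
    change ‖((((m₁ : ℕ) : O) - ((m₂ : ℕ) : O) : O) : K)‖ < 1 at h
    rwa [hval] at h
  have hcard : Fintype.card (O ⧸ maximalIdeal O) = p := by
    rw [← Nat.card_eq_fintype_card]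
    have h := card_residueField p K
    rw [hf, pow_one] at h
    exact h
  have hsurj : Function.Surjective ι :=
    (Finite.injective_iff_surjective_of_equiv ((Fintype.equivFinOfCardEq hcard).symm)).mp hinj
  obtain ⟨m, hm⟩ := hsurj (Ideal.Quotient.mk (maximalIdeal O) ⟨x, Valued.integer.mem_iff.mpr hx⟩)
  refine ⟨m, m.2, ?_⟩
  change Ideal.Quotient.mk (maximalIdeal O) (((m : ℕ) : O)) = _ at hm
  rw [Ideal.Quotient.eq, mem_maximalIdeal_iff_norm_lt_one] at hm
  have hval : ((((m : ℕ) : O) - ⟨x, Valued.integer.mem_iff.mpr hx⟩ : O) : K) = (m : K) - x := by push_cast; rfl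
  change ‖((((m : ℕ) : O) - ⟨x, Valued.integer.mem_iff.mpr hx⟩ : O) : K)‖ < 1 at hm
  rw [hval, ← norm_neg, neg_sub] at hm
  exact hm

end Summit.ABC.IUTFork.Thm311.Real.Hull

namespace Summit.ABC.IUTFork.Thm311.Real

open NumberField IsDedekindDomain Literature.NumberTheory.NumberFields Literature.IUT.LogVolume
open Literature.NumberTheory.GaloisRepresentations Literature.NumberTheory.GaloisRepresentations.Ultrametric
open Literature.AnabelianGeometry.AbsoluteAnabelian Literature.IUT.HodgeArakelov
open Literature.IUT.HodgeArakelov.AbsTopMonoids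

variable {F : Type} [Field F] [NumberField F] (v : HeightOneSpectrum (𝓞 F))

/-! ## §0b The bit, read at `1`: `ψ(p) − p ∈ p·log_p(𝒪_v^×)` iff `ψ(1) − 1 ∈ log_p(𝒪_v^×)` -/

/-- **The base line modulo `𝔪_v^{e+1}`, read at `1`.**  For `ψ` in print's (Ind1) strip part (bicontinuous, hence `ℚ_p`-linear):
`ψ(p) − p ∈ p·log_p(𝒪_v^×)` iff `ψ(1) − 1 ∈ log_p(𝒪_v^×)` — the realised strip group fixes the base line `ℤ_p·p = log_p(1+pℤ_p)` modulo
`p·log_p(𝒪_v^×) = 𝔪_v^{e+1}` (tame) iff it fixes `1` modulo `log_p(𝒪_v^×) = 𝔪_v`. [claim: Mochizuki2012, status: disputed]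
[cite: Mochizuki2012, IUTchIII Thm. 3.11 (i) p. 154] -/
theorem of_apply_natCast_sub_mem_smul_logUnits_iff (p : ℕ) [Fact p.Prime] (hv : ((p : ℕ) : 𝓞 F) ∈ v.asIdeal)
    {ψ : v.adicCompletion F ≃+ v.adicCompletion F} (hψ : ψ ∈ ind1StripOf v (galoisLog v)) :
    RescaledCompletion.of F p v hv (ψ (p : v.adicCompletion F)) - (p : RescaledCompletion F p v hv) ∈
        (p : ℚ_[p]) • logUnits (RescaledCompletion F p v hv) ↔
      RescaledCompletion.of F p v hv (ψ 1) - 1 ∈ logUnits (RescaledCompletion F p v hv) := by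
  set R := RescaledCompletion F p v hv
  set e := RescaledCompletion.of F p v hv with he_def
  have hP : p.Prime := Fact.out
  have hpQ : (p : ℚ_[p]) ≠ 0 := by exact_mod_cast hP.ne_zero
  obtain ⟨hcont, -, -, -⟩ := id hψ
  let f : R →+ R :=
    { toFun := fun a => e (ψ (e.symm a))
      map_zero' := by rw [map_zero, map_zero, map_zero]
      map_add' := fun a b => by rw [map_add, map_add, map_add] }
  have hfc : Continuous f := hcont
  have hf_smul : ∀ (a : ℚ_[p]) (z : R), f (a • z) = a • f z := fun a z => map_padic_smul_of_continuous p f hfc a z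
  have hpR : (p : R) = (p : ℚ_[p]) • (1 : R) := by
    rw [← map_natCast (algebraMap ℚ_[p] R) p, Algebra.algebraMap_eq_smul_one]
  have hep : e (ψ (p : v.adicCompletion F)) = (p : ℚ_[p]) • e (ψ 1) := by
    have h1 : e (ψ (p : v.adicCompletion F)) = f (p : R) := by
      show e (ψ (p : v.adicCompletion F)) = e (ψ (e.symm (p : R)))
      rw [map_natCast e.symm]
    have h2 : e (ψ 1) = f 1 := by
      show e (ψ 1) = e (ψ (e.symm 1)); rw [map_one e.symm]
    rw [h1, h2, hpR, hf_smul]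
  rw [hep, hpR, ← smul_sub]
  exact Set.smul_mem_smul_set_iff₀ hpQ _ _

/-! ## §0c The strip part is closed under inverses -/

/-- **`ψ⁻¹` lies in print's (Ind1) strip part whenever `ψ` does**: `ψ⁻¹` is bicontinuous and realises THE lift of `φ⁻¹`
(`liftUnits v φ.symm` inverts `liftUnits v φ`). [claim: Mochizuki2012, status: disputed] [cite: Mochizuki2012, IUTchIII Thm. 3.11 (i) p. 154] -/
theorem symm_mem_ind1StripOf (L : Additive (↥(v.adicCompletionIntegers F))ˣ →+ v.adicCompletion F)
    {ψ : v.adicCompletion F ≃+ v.adicCompletion F} (hψ : ψ ∈ ind1StripOf v L) : ψ.symm ∈ ind1StripOf v L := by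
  obtain ⟨hc, hc', φ, hφ⟩ := hψ
  refine ⟨hc', by rw [AddEquiv.symm_symm]; exact hc, φ.symm, ?_⟩
  rw [realises_stripMulAut_iff] at hφ ⊢
  intro u
  apply ψ.injective
  have hu : liftUnits v φ (liftUnits v φ.symm u) = u := by
    have h := liftUnitsFun_symm_apply v φ.symm u
    rw [ContinuousMulEquiv.symm_symm] at h
    rw [liftUnits_apply, liftUnits_apply]
    exact h
  rw [AddEquiv.apply_symm_apply, hφ, hu]

/-! ## §1 UNCONDITIONAL (`f(v|p) = 1`): if NO strip automorphism moves the base line mod `𝔪_v^{e+1}`, the depth-`e` ball is FIXED -/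

/-- **BRANCH (ii) OF THE DICHOTOMY (UNCONDITIONAL): no base-line mover ⇒ the depth-`e` ball is strip-invariant.**  At a tame place
`v ∣ p` (`p > 2`, `e = e(v|p) ≤ p − 2`) of residue degree `f(v|p) = 1`, suppose NO `ψ` in print's (Ind1) strip part `Real.ind1StripOf v (galoisLog v)`
moves the base line modulo `p·log_p(𝒪_v^×) = 𝔪_v^{e+1}` (`ψ(p) − p ∈ p·log_p(𝒪_v^×)` for all `ψ`).  Then for every `ψ` and every `x` in the
depth-`e` ball `M = {‖x‖ ≤ ‖c‖·p⁻¹}` (`= c·𝔪_v^e = p·c·𝒪_v`, `c ≠ 0`): the displacement `ψ x − x` lies in `p·c·log_p(𝒪_v^×) = c·𝔪_v^{e+1}`, has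
norm `≤ ‖c‖·p^{−(e+1)/e} < ‖c‖·p⁻¹`, and `ψ x ∈ M`.  Proof: `𝒪_v = ℤ + 𝔪_v` (residue degree one, §0), `ψ − 1` is `ℚ_p`-linear, maps `log_p(𝒪_v^×)`
into itself (R17b §1, L-stability) and `1` into `p⁻¹·(ψ(p) − p) ∈ log_p(𝒪_v^×)`.  So the strip orbit of `M` — under the whole group generated —
is `M` itself: the orbit span is `M`, of hull `closedBall 0 (‖c‖·p⁻¹)`, NOT the container's `closedBall 0 (‖c‖·p^{−1/e})` (defect `e − 1` steps
of `𝔪_v` when `e ≥ 2`). [claim: Mochizuki2012, status: disputed] [cite: Mochizuki2012, IUTchIII Thm. 3.11 (i) p. 154; Cor. 3.12 Step (xi) p. 183]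
[cite: SerreLocalFields1979, Ch. I §6] -/
theorem of_apply_sub_mem_smul_logUnits_of_fixesBaseLine
    (p : ℕ) [Fact p.Prime] (hv : ((p : ℕ) : 𝓞 F) ∈ v.asIdeal) (hp2 : 2 < p)
    (he : absRamificationIdx p (RescaledCompletion F p v hv) ≤ p - 2) (hf : v.asIdeal.inertiaDeg ℤ = 1)
    {c : ℚ_[p]} (hc : c ≠ 0)
    (hfix : ∀ ψ ∈ ind1StripOf v (galoisLog v),
      RescaledCompletion.of F p v hv (ψ (p : v.adicCompletion F)) - (p : RescaledCompletion F p v hv) ∈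
        (p : ℚ_[p]) • logUnits (RescaledCompletion F p v hv))
    {ψ : v.adicCompletion F ≃+ v.adicCompletion F} (hψ : ψ ∈ ind1StripOf v (galoisLog v))
    {x : v.adicCompletion F} (hx : ‖RescaledCompletion.of F p v hv x‖ ≤ ‖c‖ * (p : ℝ)⁻¹) :
    RescaledCompletion.of F p v hv (ψ x) - RescaledCompletion.of F p v hv x ∈
        ((p : ℚ_[p]) * c) • logUnits (RescaledCompletion F p v hv) ∧
      ‖RescaledCompletion.of F p v hv (ψ x) - RescaledCompletion.of F p v hv x‖ ≤
        ‖c‖ * (p : ℝ) ^ (-(((absRamificationIdx p (RescaledCompletion F p v hv) : ℝ) + 1) /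
          (absRamificationIdx p (RescaledCompletion F p v hv) : ℝ))) ∧
      ‖c‖ * (p : ℝ) ^ (-(((absRamificationIdx p (RescaledCompletion F p v hv) : ℝ) + 1) /
          (absRamificationIdx p (RescaledCompletion F p v hv) : ℝ))) < ‖c‖ * (p : ℝ)⁻¹ ∧
      ‖RescaledCompletion.of F p v hv (ψ x)‖ ≤ ‖c‖ * (p : ℝ)⁻¹ := by
  set R := RescaledCompletion F p v hv
  set e := RescaledCompletion.of F p v hv with he_def
  set E := absRamificationIdx p (RescaledCompletion F p v hv) with hE_def
  have hP : p.Prime := Fact.out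
  have hp1 : (1 : ℝ) < p := by exact_mod_cast hP.one_lt
  have hp0 : (0 : ℝ) < p := by positivity
  have hpQ : (p : ℚ_[p]) ≠ 0 := by exact_mod_cast hP.ne_zero
  have hE0 : 0 < E := absRamificationIdx_pos p R
  have hE0' : (0 : ℝ) < E := by exact_mod_cast hE0
  have hc0 : 0 < ‖c‖ := norm_pos_iff.mpr hc
  -- tame: `log_p(𝒪_v^×) = {‖z‖ < 1}`, norms `≤ p^{-1/E}`, a `ℤ_p`-module
  have hL : ∀ z : R, z ∈ logUnits R ↔ ‖z‖ < 1 := fun z => mem_logUnits_iff_norm_lt_one_of_tame p hp2 he z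
  have hLle : ∀ z ∈ logUnits R, ‖z‖ ≤ (p : ℝ) ^ (-(1 / (E : ℝ))) :=
    fun z hz => norm_le_rpow_of_norm_lt_one p R ((hL z).mp hz)
  have hLsmul : ∀ (u : ℚ_[p]) (z : R), ‖u‖ ≤ 1 → z ∈ logUnits R → u • z ∈ logUnits R := by
    intro u z hu hz
    set u' : ℤ_[p] := ⟨u, hu⟩ with hu'
    have h := smul_mem_logUnits p R u' hz
    rwa [← algebraMap_smul ℚ_[p] u' z] at h
  have hLadd : ∀ a b : R, a ∈ logUnits R → b ∈ logUnits R → a + b ∈ logUnits R := fun a b ha hb =>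
    (logUnitsAddSubgroup p R).add_mem (show a ∈ logUnitsAddSubgroup p R from ha) (show b ∈ logUnitsAddSubgroup p R from hb)
  -- `ψ` read on `R`, `ℚ_p`-linear by continuity
  obtain ⟨hcont, -, -, -⟩ := id hψ
  let f : R →+ R :=
    { toFun := fun a => e (ψ (e.symm a))
      map_zero' := by rw [map_zero, map_zero, map_zero]
      map_add' := fun a b => by rw [map_add, map_add, map_add] }
  have hfc : Continuous f := hcont
  have hf_smul : ∀ (a : ℚ_[p]) (z : R), f (a • z) = a • f z := fun a z => map_padic_smul_of_continuous p f hfc a z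
  have hfx : ∀ y : v.adicCompletion F, e (ψ y) = f (e y) := fun y => by
    show e (ψ y) = e (ψ (e.symm (e y))); rw [e.symm_apply_apply]
  -- `ψ − 1` maps `log_p(𝒪_v^×)` into itself (L-stability, R17b §1) …
  have hfL : ∀ z ∈ logUnits R, f z - z ∈ logUnits R := by
    intro z hz
    have hz1 : e (e.symm z) ∈ (1 : ℚ_[p]) • logUnits R := by rw [one_smul, e.apply_symm_apply]; exact hz
    have h := (sub_mem_smul_logUnits_inter_ker_trace_of_mem_ind1StripOf v p hv hψ 1 hz1).1
    rw [one_smul, e.apply_symm_apply] at h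
    exact h
  -- … and `1` into `log_p(𝒪_v^×)` (the hypothesis, divided by `p`)
  have hpR : (p : R) = (p : ℚ_[p]) • (1 : R) := by
    rw [← map_natCast (algebraMap ℚ_[p] R) p, Algebra.algebraMap_eq_smul_one]
  have hf1 : f 1 - 1 ∈ logUnits R := by
    have h := hfix ψ hψ
    have h1 : e (ψ (p : v.adicCompletion F)) = f (p : R) := by
      show e (ψ (p : v.adicCompletion F)) = e (ψ (e.symm (p : R))); rw [map_natCast e.symm]
    rw [h1, hpR, hf_smul, ← smul_sub] at h
    exact (Set.smul_mem_smul_set_iff₀ hpQ _ _).mp h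
  -- `x = (p·c)·x'`, `‖x'‖ ≤ 1`, and `x' = m·1 + z`, `z ∈ log_p(𝒪_v^×)` (residue degree one)
  have hpc0 : (p : ℚ_[p]) * c ≠ 0 := mul_ne_zero hpQ hc
  have hpcn : ‖(p : ℚ_[p]) * c‖ = ‖c‖ * (p : ℝ)⁻¹ := by rw [norm_mul, Padic.norm_p, mul_comm]
  have hpcn0 : 0 < ‖c‖ * (p : ℝ)⁻¹ := by positivity
  set x' : R := ((p : ℚ_[p]) * c)⁻¹ • e x with hx'
  have hx'1 : ‖x'‖ ≤ 1 := by
    rw [hx', norm_smul, norm_inv, hpcn, inv_mul_le_iff₀ hpcn0, mul_one]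
    exact hx
  have hex : e x = ((p : ℚ_[p]) * c) • x' := by rw [hx', smul_smul, mul_inv_cancel₀ hpc0, one_smul]
  have hf1' : residueDegree p R = 1 := by
    have h := residueDegree_rescaledCompletion F p v hv
    change residueDegree p R = _ at h
    rw [h, hf]
  obtain ⟨m, -, hm⟩ := Hull.exists_norm_sub_natCast_lt_one_of_residueDegree_eq_one p R hf1' x' hx'1
  set z : R := x' - (m : R) with hz
  have hzL : z ∈ logUnits R := (hL z).mpr hm
  have hmR : (m : R) = (m : ℚ_[p]) • (1 : R) := by
    rw [← map_natCast (algebraMap ℚ_[p] R) m, Algebra.algebraMap_eq_smul_one]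
  have hx'eq : x' = (m : ℚ_[p]) • (1 : R) + z := by rw [hz, hmR]; abel
  -- the displacement
  have hdisp : f (e x) - e x = ((p : ℚ_[p]) * c) • ((m : ℚ_[p]) • (f 1 - 1) + (f z - z)) := by
    rw [hex, hx'eq]
    simp only [map_add, hf_smul, smul_add, smul_sub]
    abel
  have hinner : (m : ℚ_[p]) • (f 1 - 1) + (f z - z) ∈ logUnits R :=
    hLadd _ _ (hLsmul _ _ (by exact_mod_cast Padic.norm_int_le_one (m : ℤ)) hf1) (hfL z hzL)
  have hmem : e (ψ x) - e x ∈ ((p : ℚ_[p]) * c) • logUnits R := by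
    rw [hfx, hdisp]; exact Set.smul_mem_smul_set hinner
  have hexp : ‖c‖ * (p : ℝ)⁻¹ * (p : ℝ) ^ (-(1 / (E : ℝ))) = ‖c‖ * (p : ℝ) ^ (-(((E : ℝ) + 1) / (E : ℝ))) := by
    rw [show -(((E : ℝ) + 1) / (E : ℝ)) = (-1 : ℝ) + (-(1 / (E : ℝ))) by field_simp; ring, Real.rpow_add hp0,
      Real.rpow_neg_one]
    ring
  have hnorm : ‖e (ψ x) - e x‖ ≤ ‖c‖ * (p : ℝ) ^ (-(((E : ℝ) + 1) / (E : ℝ))) := by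
    rw [hfx, hdisp, norm_smul, hpcn, ← hexp]
    exact mul_le_mul_of_nonneg_left (hLle _ hinner) hpcn0.le
  have hlt : ‖c‖ * (p : ℝ) ^ (-(((E : ℝ) + 1) / (E : ℝ))) < ‖c‖ * (p : ℝ)⁻¹ := by
    rw [← hexp]
    have h1 : (p : ℝ) ^ (-(1 / (E : ℝ))) < 1 :=
      Real.rpow_lt_one_of_one_lt_of_neg hp1 (by rw [neg_lt_zero]; positivity)
    calc ‖c‖ * (p : ℝ)⁻¹ * (p : ℝ) ^ (-(1 / (E : ℝ))) < ‖c‖ * (p : ℝ)⁻¹ * 1 := mul_lt_mul_of_pos_left h1 hpcn0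
      _ = ‖c‖ * (p : ℝ)⁻¹ := mul_one _
  refine ⟨hmem, hnorm, hlt, ?_⟩
  have h := IsUltrametricDist.norm_add_le_max (e (ψ x) - e x) (e x)
  rw [sub_add_cancel] at h
  exact h.trans (max_le (hnorm.trans hlt.le) hx)

/-- **Corollary (UNCONDITIONAL): every realised strip automorphism carries the depth-`e` ball ONTO itself** when none moves the base
line mod `𝔪_v^{e+1}` (`f(v|p) = 1`, tame): `ψ(M) = M` (`⊆` by the previous theorem for `ψ`, `⊇` by the previous theorem for `ψ⁻¹ ∈
Real.ind1StripOf v (galoisLog v)`, §0c). [claim: Mochizuki2012, status: disputed] [cite: Mochizuki2012, IUTchIII Thm. 3.11 (i) p. 154] -/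
theorem image_depthE_ball_eq_of_fixesBaseLine
    (p : ℕ) [Fact p.Prime] (hv : ((p : ℕ) : 𝓞 F) ∈ v.asIdeal) (hp2 : 2 < p)
    (he : absRamificationIdx p (RescaledCompletion F p v hv) ≤ p - 2) (hf : v.asIdeal.inertiaDeg ℤ = 1)
    {c : ℚ_[p]} (hc : c ≠ 0)
    (hfix : ∀ ψ ∈ ind1StripOf v (galoisLog v),
      RescaledCompletion.of F p v hv (ψ (p : v.adicCompletion F)) - (p : RescaledCompletion F p v hv) ∈
        (p : ℚ_[p]) • logUnits (RescaledCompletion F p v hv))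
    {ψ : v.adicCompletion F ≃+ v.adicCompletion F} (hψ : ψ ∈ ind1StripOf v (galoisLog v)) :
    ψ '' {x | ‖RescaledCompletion.of F p v hv x‖ ≤ ‖c‖ * (p : ℝ)⁻¹} =
      {x | ‖RescaledCompletion.of F p v hv x‖ ≤ ‖c‖ * (p : ℝ)⁻¹} := by
  apply Set.Subset.antisymm
  · rintro _ ⟨x, hx, rfl⟩
    exact (of_apply_sub_mem_smul_logUnits_of_fixesBaseLine v p hv hp2 he hf hc hfix hψ hx).2.2.2
  · intro x hx
    refine ⟨ψ.symm x, ?_, ψ.apply_symm_apply x⟩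
    exact (of_apply_sub_mem_smul_logUnits_of_fixesBaseLine v p hv hp2 he hf hc hfix (symm_mem_ind1StripOf v _ hψ) hx).2.2.2

/-- **THE STRIP ORBIT OF THE DEPTH-`e` BALL IS THE BALL (branch (ii), UNCONDITIONAL).**  At a tame place of residue degree one where no realised
strip automorphism moves the base line mod `𝔪_v^{e+1}`, EVERY element of the group generated by print's (Ind1) strip part
`Real.ind1StripOf v (galoisLog v)` (inside `AddAut K_v`, which Mathlib writes additively) carries `M = {‖x‖ ≤ ‖c‖·p⁻¹}` onto itself — so the additive span of the whole strip orbit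
of `M` is `M` (an additive subgroup), whose `𝒪_{K_v}`-hull is `closedBall 0 (‖c‖·p⁻¹)` (next theorem), not the container's `closedBall 0 (‖c‖·p^{−1/e})`.
[claim: Mochizuki2012, status: disputed] [cite: Mochizuki2012, IUTchIII Thm. 3.11 (i) p. 154; Cor. 3.12 Step (xi) p. 183] -/
theorem image_depthE_ball_eq_of_mem_closure_of_fixesBaseLine
    (p : ℕ) [Fact p.Prime] (hv : ((p : ℕ) : 𝓞 F) ∈ v.asIdeal) (hp2 : 2 < p)
    (he : absRamificationIdx p (RescaledCompletion F p v hv) ≤ p - 2) (hf : v.asIdeal.inertiaDeg ℤ = 1)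
    {c : ℚ_[p]} (hc : c ≠ 0)
    (hfix : ∀ ψ ∈ ind1StripOf v (galoisLog v),
      RescaledCompletion.of F p v hv (ψ (p : v.adicCompletion F)) - (p : RescaledCompletion F p v hv) ∈
        (p : ℚ_[p]) • logUnits (RescaledCompletion F p v hv))
    {γ : AddAut (v.adicCompletion F)}
    (hγ : γ ∈ AddSubgroup.closure (G := AddAut (v.adicCompletion F)) (ind1StripOf v (galoisLog v))) :
    γ '' {x | ‖RescaledCompletion.of F p v hv x‖ ≤ ‖c‖ * (p : ℝ)⁻¹} =
      {x | ‖RescaledCompletion.of F p v hv x‖ ≤ ‖c‖ * (p : ℝ)⁻¹} := by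
  set M : Set (v.adicCompletion F) := {x | ‖RescaledCompletion.of F p v hv x‖ ≤ ‖c‖ * (p : ℝ)⁻¹} with hM
  -- Mathlib writes the automorphism group `AddAut K_v` ADDITIVELY: `γ₁ + γ₂ = γ₂ ≫ γ₁`, `0 = id`, `−γ = γ⁻¹`
  induction hγ using AddSubgroup.closure_induction with
  | mem ψ hψ => exact image_depthE_ball_eq_of_fixesBaseLine v p hv hp2 he hf hc hfix hψ
  | zero => rw [AddAut.coe_zero]; exact Set.image_id M
  | add γ₁ γ₂ _ _ ih₁ ih₂ => rw [AddAut.coe_add, Set.image_comp, ih₂, ih₁]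
  | neg γ _ ih =>
    rw [AddAut.coe_neg]
    have h := congrArg (fun S => γ.symm '' S) ih
    simp only [Set.image_image, AddEquiv.symm_apply_apply, Set.image_id'] at h
    exact h.symm

/-- **The hull of the depth-`e` ball itself** (the value of branch (ii)): the `𝒪_{K_v}`-module hull of `M = {‖x‖ ≤ ‖c‖·p⁻¹}` is
`closedBall 0 (‖c‖·p⁻¹)` (`M` is an `𝒪_{K_v}`-module attaining its radius at `p·c·1`), and at ramification index `e ≥ 2` this radius is STRICTLY
below the container's `‖c‖·p^{−1/e}` — the defect of branch (ii) is `e − 1` steps of `𝔪_v` (log-volume `(e−1)/e·log p` per unit weight).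
[claim: Mochizuki2012, status: disputed] [cite: Mochizuki2012, IUTchIII Rmk. 3.9.5 (i) p. 126; IUTchIV Prop. 1.2 (i) p. 10] -/
theorem coe_span_depthE_ball_eq_closedBall (p : ℕ) [Fact p.Prime] (hv : ((p : ℕ) : 𝓞 F) ∈ v.asIdeal) (c : ℚ_[p]) :
    (Submodule.span (Valued.integer (RescaledCompletion F p v hv))
        {x : RescaledCompletion F p v hv | ‖x‖ ≤ ‖c‖ * (p : ℝ)⁻¹} : Set (RescaledCompletion F p v hv)) =
      closedBall 0 (‖c‖ * (p : ℝ)⁻¹) ∧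
    (2 ≤ absRamificationIdx p (RescaledCompletion F p v hv) → c ≠ 0 →
      ‖c‖ * (p : ℝ)⁻¹ < ‖c‖ * (p : ℝ) ^ (-(1 / (absRamificationIdx p (RescaledCompletion F p v hv) : ℝ)))) := by
  set R := RescaledCompletion F p v hv
  have hP : p.Prime := Fact.out
  have hp1 : (1 : ℝ) < p := by exact_mod_cast hP.one_lt
  have hp0 : (0 : ℝ) < p := by positivity
  refine ⟨Hull.coe_span_eq_closedBall_of_isGreatest _ (valuedInteger_norm_le_one v p hv)
    (fun _ h => mem_valuedInteger_of_norm_le_one v p hv h) ⟨⟨((p : ℚ_[p]) * c) • (1 : R), ?_, ?_⟩, ?_⟩, fun hE hc => ?_⟩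
  · change ‖((p : ℚ_[p]) * c) • (1 : R)‖ ≤ _
    rw [norm_smul, norm_one, mul_one, norm_mul, Padic.norm_p, mul_comm]
  · change ‖((p : ℚ_[p]) * c) • (1 : R)‖ = _
    rw [norm_smul, norm_one, mul_one, norm_mul, Padic.norm_p, mul_comm]
  · rintro _ ⟨x, hx, rfl⟩; exact hx
  · have hc0 : 0 < ‖c‖ := norm_pos_iff.mpr hc
    refine mul_lt_mul_of_pos_left ?_ hc0
    rw [← Real.rpow_neg_one]
    refine (Real.rpow_lt_rpow_left_iff hp1).mpr ?_
    have hE' : (2 : ℝ) ≤ absRamificationIdx p R := by exact_mod_cast hE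
    have hEpos : (0 : ℝ) < absRamificationIdx p R := by linarith
    have : (1 : ℝ) / (absRamificationIdx p R : ℝ) ≤ 1 / 2 := by
      rw [one_div_le_one_div hEpos (by norm_num)]; exact hE'
    linarith

end Summit.ABC.IUTFork.Thm311.Real

end
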